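import Summits.QuantumFields.YangMills.Theorems.TwistedTraceScaling.Negative.CentralGaussianRadiusWindowLocal
import HarnessLib

/-!
# Negative lemma R47a (cdisprove g39) — the EUCLIDEAN (plaquette) zero of the smeared BO function
# (crux `TwistedTraceScaling` stmt-QuantumFields-20203, skeleton «twolattice»; vets `…BOCentralTube` §4 = p686369:
# `central_transfer_two_sided_of_localisedAvg_local`, the landed relative-local (C1) glue; consequences in `…Negative.CentralEuclideanRadiusWindow`)

R45/R46/R46L located zeros of the gauge average `A = A_W(χ₀⊗Ω)` at chart points whose distance from the centre is measured on the SUP-NORM / gauge scale `T`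
(two-link witnesses at `≈ 8.2T`); with the scales of record (`T = T_W ≈ 7.5Lβ^{-1/2}ℓ²` much larger than the fibre radii) those zeros lie outside the `hAlo` ball and do not bite
(lane A, COARSE-DESIGN §28.6).  This file replaces the sup-norm radius by a EUCLIDEAN one, in which `T` enters only squared:
`smearedBO_singleLink_eq_zero` ★★★ — under the glue's support hypotheses (`Ω(linkEmbed v) ≠ 0 ⇒ |v_{e,c}| ≤ T₁ ∧ ‖linkEmbed v‖ ≤ R`, `W g ≠ 0 ⇒ ‖q(g_x)−1‖ ≤ T₂`),
`A(P(b·e₀ ⊗ δ_{(x₁,k)})) = 0` as soon as `‖q(P(1,b e₀)) − 1‖ > 6R + 2(3T₁+2T₂)²` (so for `|b| ≥ 7R + 58T²` when `T₁ = T₂ = T ≤ 1/30`, `|b| ≤ 1/2`).  MECHANISM: the plaquette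
holonomy is gauge-COVARIANT (`hol_gaugeTransform`); at the single-link point it is `P(1,b e₀)`, at distance `≥ (7/8)|b|` from `1` (`norm_su2Quat_gnoPoint_single_sub_one_ge`); along
any tube configuration `orthoTube u′ v′` of the orbit it is within `Σ_{e∈p}‖q(chartSU2 v′_e)−1‖ + 2‖q(u′_k)−1‖‖q(u′_l)−1‖ ≤ 6‖linkEmbed v′‖ + 2(3T₁+2T₂)²` of `1`
(`norm_su2Quat_plaquette_sub_one_le`: the slow factors enter only through a commutator) — so `‖linkEmbed v′‖ > R` and `Ω = 0` on the whole `W`-visible orbit.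
READING: on paper the transverse zeros of `A` sit already at Euclidean radius `≈ R_Ω(1+O(T))`; this file certifies `(8/7)(6R_Ω + 2(3T_Ω+2T_W)²)` with separate scales, which is
what any restatement of the glue's `hAlo` must respect (see the Window file for the consequence on the landed one-radius glue).
HONEST FRAMING: negative/boundary lemmas (helper, `--supports stmt-QuantumFields-20203`) about hypotheses of bricks of a stub of a child of the CONDITIONAL reduction route R2b1; nothing
here refutes or proves `TwistedTraceScaling`, S-BASE, (B-OD) or C4-CORE; not infinite volume, not a gap, not Clay. bears_on R2b1.
-/

set_option autoImplicit false

noncomputable section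

open MeasureTheory Filter Topology Real
open scoped BigOperators RealInnerProductSpace Quaternion
open Literature.MathematicalPhysics.QuantumFieldTheory hiding SU2
open Literature.MathematicalPhysics.QuantumLattice

namespace Summit.QuantumFields.YangMills.Theorems.TwistedTraceScaling.Negative.R47

open Summit.QuantumFields.YangMills.Theorems.FemtoTransferGap
open Summit.QuantumFields.YangMills.Theorems.FemtoTransferGap.TwoLattice
open Summit.QuantumFields.YangMills.Theorems.FemtoTransferGap.TwoLattice.Avg
open Summit.QuantumFields.YangMills.Theorems.FemtoTransferGap.TwoLattice.ConstTube
open Summit.QuantumFields.YangMills.Theorems.FemtoTransferGap.TwoLattice.Stiff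
open Summit.QuantumFields.YangMills.Theorems.FemtoTransferGap.TwoLattice.GnChart
open Summit.QuantumFields.YangMills.Theorems.TwistedTraceScaling.Negative.R45
open Summit.QuantumFields.YangMills.Theorems.TwistedTraceScaling.Negative.R46
open Summit.QuantumFields.YangMills.Theorems.TwistedTraceScaling.Negative.R46L
open Literature.MathematicalPhysics.QuantumFieldTheory.Balaban1983to89.T4HaarSU2Translate renaming su2Quat_mul → su2Quat_mul₄, su2Quat_one → su2Quat_one₄
open Literature.MathematicalPhysics.QuantumFieldTheory.Balaban1983to89.T4CubeChartGnomonic (gnoPoint gnoPoint_zero su2Quat_gnoPoint)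

/-! ## §1 Quaternion bookkeeping: the plaquette product of a tube configuration
(conjugation / commutator estimates are `ConstTube.norm_su2Quat_conj_sub_one`, `ConstTube.norm_su2Quat_comm_sub_one_le`). -/

/-- ★ **Plaquette product of a tube configuration.**  For links `cᵢ·u` (fibre factor `cᵢ`, slow factor `u_k` or `u_l` by direction) around a plaquette in the `(k,l)` plane,
`‖q(c₁u_k · c₂u_l · (c₃u_k)⁻¹ · (c₄u_l)⁻¹) − 1‖ ≤ Σᵢ ‖q(cᵢ) − 1‖ + 2‖q(u_k) − 1‖‖q(u_l) − 1‖`: the slow factors enter only through their commutator. [folklore] -/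
theorem norm_su2Quat_plaquette_sub_one_le (c₁ c₂ c₃ c₄ uk ul : SU2) :
    ‖su2Quat (c₁ * uk * (c₂ * ul) * (c₃ * uk)⁻¹ * (c₄ * ul)⁻¹) - 1‖ ≤
      ‖su2Quat c₁ - 1‖ + ‖su2Quat c₂ - 1‖ + ‖su2Quat c₃ - 1‖ + ‖su2Quat c₄ - 1‖ + 2 * ‖su2Quat uk - 1‖ * ‖su2Quat ul - 1‖ := by
  have e1 : c₁ * uk * (c₂ * ul) * (c₃ * uk)⁻¹ * (c₄ * ul)⁻¹ = c₁ * (uk * c₂ * (ul * uk⁻¹ * c₃⁻¹ * ul⁻¹)) * c₄⁻¹ := by group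
  have e2 : uk * (ul * uk⁻¹ * c₃⁻¹ * ul⁻¹) = uk * ul * uk⁻¹ * c₃⁻¹ * ul⁻¹ := by group
  set M := uk * c₂ * (ul * uk⁻¹ * c₃⁻¹ * ul⁻¹) with hM
  set N := uk * (ul * uk⁻¹ * c₃⁻¹ * ul⁻¹) with hN
  -- peel `c₁` (left) and `c₄⁻¹` (right)
  have t1 := norm_sub_le_norm_sub_add_norm_sub (su2Quat (c₁ * M * c₄⁻¹)) (su2Quat (c₁ * M)) 1
  have t2 := norm_sub_le_norm_sub_add_norm_sub (su2Quat (c₁ * M)) (su2Quat M) 1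
  rw [norm_su2Quat_mul_right_sub, norm_su2Quat_inv_sub_one] at t1
  rw [norm_su2Quat_mul_left_sub] at t2
  -- remove the inserted `c₂`
  have t3 := norm_sub_le_norm_sub_add_norm_sub (su2Quat M) (su2Quat N) 1
  have hMN : ‖su2Quat M - su2Quat N‖ = ‖su2Quat c₂ - 1‖ := by rw [hM, hN, norm_su2Quat_insert_sub]
  rw [hMN] at t3
  -- remove the inserted `c₃⁻¹`
  have t4 := norm_sub_le_norm_sub_add_norm_sub (su2Quat N) (su2Quat (uk * ul * uk⁻¹ * ul⁻¹)) 1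
  have hN3 : ‖su2Quat N - su2Quat (uk * ul * uk⁻¹ * ul⁻¹)‖ = ‖su2Quat c₃ - 1‖ := by
    rw [e2, norm_su2Quat_insert_sub (uk * ul * uk⁻¹) c₃⁻¹ ul⁻¹, norm_su2Quat_inv_sub_one]
  rw [hN3] at t4
  have t5 := norm_su2Quat_comm_sub_one_le uk ul
  rw [e1]
  linarith

/-! ## §2 The gnomonic link `P(1, v)`: distance to `1` -/

/-- `‖(1,v)‖² = 1 + Σ_a v_a²`. [folklore] -/
theorem norm_gnomonicQuat_sq (v : Fin 3 → ℝ) : ‖gnomonicQuat v‖ ^ 2 = 1 + ∑ a, v a ^ 2 := by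
  rw [sq, ← Quaternion.normSq_eq_norm_mul_self, Quaternion.normSq_def']
  simp only [gnomonicQuat]
  rw [Fin.sum_univ_three]; ring

/-- `‖q(P(1,v)) − 1‖² = (‖(1,v)‖⁻¹ − 1)² + ‖(1,v)‖⁻²·Σ_a v_a²`. [folklore] -/
theorem norm_su2Quat_gnoPoint_sub_one_sq (v : Fin 3 → ℝ) :
    ‖su2Quat (gnoPoint v) - 1‖ ^ 2 = (‖gnomonicQuat v‖⁻¹ - 1) ^ 2 + ‖gnomonicQuat v‖⁻¹ ^ 2 * ∑ a, v a ^ 2 := by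
  rw [su2Quat_gnoPoint, sq, ← Quaternion.normSq_eq_norm_mul_self, Quaternion.normSq_def']
  simp only [gnomonicQuat, Quaternion.re_sub, Quaternion.imI_sub, Quaternion.imJ_sub, Quaternion.imK_sub, Quaternion.re_smul, Quaternion.imI_smul,
    Quaternion.imJ_smul, Quaternion.imK_smul, smul_eq_mul, Quaternion.re_one, Quaternion.imI_one, Quaternion.imJ_one, Quaternion.imK_one]
  rw [Fin.sum_univ_three]; ring

/-- ★ `‖q(P(1,v)) − 1‖ ≥ (7/8)·√(Σ_a v_a²)` for `Σ_a v_a² ≤ 15/49` (in particular for `Σ_a v_a² ≤ 1/4`). [folklore] -/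
theorem norm_su2Quat_gnoPoint_sub_one_ge {v : Fin 3 → ℝ} (hv : ∑ a, v a ^ 2 ≤ 15 / 49) :
    7 / 8 * Real.sqrt (∑ a, v a ^ 2) ≤ ‖su2Quat (gnoPoint v) - 1‖ := by
  set s := ∑ a, v a ^ 2 with hs
  have hs0 : 0 ≤ s := Finset.sum_nonneg fun a _ => sq_nonneg _
  set n := ‖gnomonicQuat v‖ with hn
  have hn2 : n ^ 2 = 1 + s := norm_gnomonicQuat_sq v
  have hn0 : 0 < n := norm_gnomonicQuat_pos v
  have hinv : 49 / 64 ≤ n⁻¹ ^ 2 := by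
    rw [inv_pow, le_inv_comm₀ (by norm_num) (by positivity), hn2]; linarith
  have key : (7 / 8 * Real.sqrt s) ^ 2 ≤ ‖su2Quat (gnoPoint v) - 1‖ ^ 2 := by
    rw [norm_su2Quat_gnoPoint_sub_one_sq, mul_pow, Real.sq_sqrt hs0]
    nlinarith [mul_le_mul_of_nonneg_right hinv hs0, sq_nonneg (n⁻¹ - 1)]
  exact (pow_le_pow_iff_left₀ (by positivity) (norm_nonneg _) two_ne_zero).mp key

/-- The single-colour link `b·e₀`: `‖q(P(1, b e₀)) − 1‖ ≥ (7/8)|b|` for `|b| ≤ 1/2`. [folklore] -/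
theorem norm_su2Quat_gnoPoint_single_sub_one_ge {b : ℝ} (hb : |b| ≤ 1 / 2) :
    7 / 8 * |b| ≤ ‖su2Quat (gnoPoint (Pi.single (0 : Fin 3) b)) - 1‖ := by
  have h := norm_su2Quat_gnoPoint_sub_one_ge (v := Pi.single (0 : Fin 3) b) (by rw [sum_sq_single_zero]; nlinarith [abs_nonneg b, sq_abs b])
  rwa [sum_sq_single_zero, Real.sqrt_sq_eq_abs] at h

variable {L : ℕ} [NeZero L]

/-! ## §3 The single-link chart point `P(b·e₀ ⊗ δ_{(x₁,k)})` and its plaquette -/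

omit [NeZero L] in
/-- Links of the single-link chart point: `P(1, b e₀)` on `(x₁,k)`, `1` elsewhere. [folklore] -/
theorem singleLink_chart_apply (x₁ : Site 3 L) (k : Fin 3) (b : ℝ) (e : Edge 3 L) :
    latPatternChart L (fun _ => false) (Pi.single (x₁, k) (Pi.single (0 : Fin 3) b)) e =
      if e = (x₁, k) then gnoPoint (Pi.single (0 : Fin 3) b) else 1 := by
  rw [latPatternChart_false]
  by_cases h : e = (x₁, k)
  · subst h; rw [if_pos rfl, Pi.single_eq_same]
  · rw [if_neg h, Pi.single_eq_of_ne h, gnoPoint_zero]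

omit [NeZero L] in
/-- per-link size of the single-link vector: `Σ_a w(e)_a² ≤ b²`. [folklore] -/
theorem singleLink_sum_sq_le (x₁ : Site 3 L) (k : Fin 3) (b : ℝ) (e : Edge 3 L) :
    ∑ a, (Pi.single (x₁, k) (Pi.single (0 : Fin 3) b) : Edge 3 L → Fin 3 → ℝ) e a ^ 2 ≤ b ^ 2 := by
  by_cases h : e = (x₁, k)
  · subst h; rw [Pi.single_eq_same, sum_sq_single_zero]
  · rw [Pi.single_eq_of_ne h]; simpa using sq_nonneg b

/-- total size of the single-link vector: `Σ_e Σ_a w(e)_a² = b²`. [folklore] -/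
theorem singleLink_sum_sum_sq (x₁ : Site 3 L) (k : Fin 3) (b : ℝ) :
    ∑ e, ∑ a, (Pi.single (x₁, k) (Pi.single (0 : Fin 3) b) : Edge 3 L → Fin 3 → ℝ) e a ^ 2 = b ^ 2 := by
  rw [Finset.sum_eq_single (x₁, k)]
  · rw [Pi.single_eq_same, sum_sq_single_zero]
  · intro e _ he; rw [Pi.single_eq_of_ne he]; simp
  · intro h; exact absurd (Finset.mem_univ _) h

/-- `‖chartVec (b·e₀ ⊗ δ_{(x₁,k)})‖ = |b|`. [folklore] -/
theorem norm_chartVec_singleLink (x₁ : Site 3 L) (k : Fin 3) (b : ℝ) :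
    ‖chartVec (Pi.single (x₁, k) (Pi.single (0 : Fin 3) b) : Edge 3 L → Fin 3 → ℝ)‖ = |b| := by
  have h : ‖chartVec (Pi.single (x₁, k) (Pi.single (0 : Fin 3) b) : Edge 3 L → Fin 3 → ℝ)‖ ^ 2 = |b| ^ 2 := by
    rw [chartVec_eq_linkEmbed, norm_linkEmbed_sq, singleLink_sum_sum_sq, sq_abs]
  exact (pow_left_inj₀ (norm_nonneg _) (abs_nonneg _) two_ne_zero).mp h

omit [NeZero L] in
/-- ★ **Gauge covariance of the plaquette holonomy** at `x` in the plane `(k,l)`: `hol(U^{g}) = g_x · hol(U) · g_x⁻¹`. [folklore] -/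
theorem hol_gaugeTransform (g : Site 3 L → SU2) (U : GaugeConfig 3 L SU2) (x : Site 3 L) (k l : Fin 3) :
    gaugeTransform g U (x, k) * gaugeTransform g U (x.shift k, l) * (gaugeTransform g U (x.shift l, k))⁻¹ * (gaugeTransform g U (x, l))⁻¹ =
      g x * (U (x, k) * U (x.shift k, l) * (U (x.shift l, k))⁻¹ * (U (x, l))⁻¹) * (g x)⁻¹ := by
  have hs : (x.shift k).shift l = (x.shift l).shift k := add_right_comm _ _ _
  unfold gaugeTransform
  dsimp only
  rw [hs]; group

/-! ## §4 ★★★ The smeared BO function vanishes at the single-link chart point beyond the EUCLIDEAN radius `6R + 2(3T₁+2T₂)²` -/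

/-- ★★★ **Euclidean (plaquette) obstruction.**  Under the support hypotheses of the (C1) glue — `Ω(linkEmbed v) ≠ 0 ⇒ |v_{e,c}| ≤ T₁ ∧ ‖linkEmbed v‖ ≤ R` and
`W g ≠ 0 ⇒ ‖q(g_x) − 1‖ ≤ T₂` at every site — the gauge average `A_W(χ₀⊗Ω)(V) = ∫ W g · boFun χ₀ Ω (V^{g⁻¹}) dg` is ZERO at the single-link chart point
`V = P(b·e₀ ⊗ δ_{(x₁,k)})` as soon as `‖q(P(1, b e₀)) − 1‖ > 6R + 2(3T₁ + 2T₂)²` (e.g. `|b| ≥ 7R + 58T²` for `T₁ = T₂ = T ≤ 1/30`, `|b| ≤ 1/2`), given a direction `l ≠ k` with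
`x₁ + e_l ≠ x₁` (`L ≥ 2`).  MECHANISM (new w.r.t. R45/R46, which used the sup-norm scale `T`): the plaquette holonomy at `x₁` in the plane `(k,l)` is GAUGE-COVARIANT, equals `P(1,b e₀)`
for `V`, and for any tube configuration `orthoTube u′ v′` in the gauge orbit it is within `Σ_{e∈p}‖q(chartSU2 v′_e) − 1‖ + 2‖q(u′_k)−1‖‖q(u′_l)−1‖ ≤ 6‖linkEmbed v′‖ + 2(3T₁+2T₂)²` of `1`
(`norm_su2Quat_plaquette_sub_one_le`; the slow factors enter only through their commutator); so `‖linkEmbed v′‖ > R` on the whole orbit and `Ω(linkEmbed v′) = 0` there. [folklore] -/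
theorem smearedBO_singleLink_eq_zero {Ω : LinkSpace L → ℝ} {W : (Site 3 L → SU2) → ℝ} {T₁ T₂ R : ℝ}
    (hΩt : ∀ v : Edge 3 L → Fin 3 → ℝ, Ω (linkEmbed L v) ≠ 0 → ∀ e c, |v e c| ≤ T₁)
    (hΩR : ∀ v : Edge 3 L → Fin 3 → ℝ, Ω (linkEmbed L v) ≠ 0 → ‖linkEmbed L v‖ ≤ R)
    (hWc : ∀ g : Site 3 L → SU2, W g ≠ 0 → ∀ x, ‖su2Quat (g x) - 1‖ ≤ T₂)
    (χ₀ : GaugeConfig 3 1 SU2 → ℝ) (x₁ : Site 3 L) {k l : Fin 3} (hkl : k ≠ l) (hl : x₁.shift l ≠ x₁) {b : ℝ}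
    (hbig : 6 * R + 2 * (3 * T₁ + 2 * T₂) ^ 2 < ‖su2Quat (gnoPoint (Pi.single (0 : Fin 3) b)) - 1‖) :
    ∫ g, W g * boFun L χ₀ Ω (gaugeTransform g⁻¹ (latPatternChart L (fun _ => false) (Pi.single (x₁, k) (Pi.single (0 : Fin 3) b)))) ∂gaugeMeasure L = 0 := by
  set V := latPatternChart L (fun _ => false) (Pi.single (x₁, k) (Pi.single (0 : Fin 3) b)) with hVdef
  have hVap : ∀ e, V e = if e = (x₁, k) then gnoPoint (Pi.single (0 : Fin 3) b) else 1 := singleLink_chart_apply x₁ k b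
  have hVk : V (x₁, k) = gnoPoint (Pi.single (0 : Fin 3) b) := by rw [hVap, if_pos rfl]
  have hk1 : V (x₁.shift l, k) = 1 := by rw [hVap, if_neg (fun h => hl (congrArg Prod.fst h))]
  have hl1 : V (x₁, l) = 1 := by rw [hVap, if_neg (fun h => hkl (congrArg Prod.snd h).symm)]
  have hkl1 : V (x₁.shift k, l) = 1 := by rw [hVap, if_neg (fun h => hkl (congrArg Prod.snd h).symm)]
  have hpt : ∀ g : Site 3 L → SU2, W g * boFun L χ₀ Ω (gaugeTransform g⁻¹ V) = 0 := by
    intro g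
    by_cases hW : W g = 0
    · rw [hW, zero_mul]
    refine mul_eq_zero_of_right _ ?_
    by_contra hb
    have hmem : gaugeTransform g⁻¹ V ∈ orthoTubeSet L := by
      by_contra hn; exact hb (boFun_eq_zero_of_not_mem L χ₀ Ω hn)
    obtain ⟨u', v', hv', hU'⟩ := hmem
    rw [← hU', boFun_orthoTube L χ₀ Ω u' hv'] at hb
    have hΩ : Ω (linkEmbed L v') ≠ 0 := fun h0 => hb (by rw [h0, mul_zero])
    have hT₁ := hΩt v' hΩ
    have hRv := hΩR v' hΩ
    have hT₂ := hWc g hW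
    have hv1 : ∀ e : Edge 3 L, ∑ c, v' e c ^ 2 ≤ 1 := sum_sq_le_one_of_cap L hv'.2
    -- every link of `V` is the `g`-dressing of the corresponding link of `U' = orthoTube u' v'`
    have hd := fun e => apply_eq_dress_of_gaugeTransform_inv g V (orthoTube L u' v') hU' e
    -- (a) links of `U'` under a trivial link of `V` are within `2T₂` of `1`
    have hU1 : ∀ e : Edge 3 L, V e = 1 → ‖su2Quat (orthoTube L u' v' e) - 1‖ ≤ 2 * T₂ := by
      intro e he
      have h0 := hd e
      rw [he] at h0
      have h1 : orthoTube L u' v' e = (g e.1)⁻¹ * g (e.1.shift e.2) := by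
        calc orthoTube L u' v' e = (g e.1)⁻¹ * (g e.1 * orthoTube L u' v' e * (g (e.1.shift e.2))⁻¹) * g (e.1.shift e.2) := by group
          _ = (g e.1)⁻¹ * g (e.1.shift e.2) := by rw [← h0]; group
      rw [h1]
      calc ‖su2Quat ((g e.1)⁻¹ * g (e.1.shift e.2)) - 1‖
          ≤ ‖su2Quat ((g e.1)⁻¹ * g (e.1.shift e.2)) - su2Quat (g (e.1.shift e.2))‖ + ‖su2Quat (g (e.1.shift e.2)) - 1‖ := norm_sub_le_norm_sub_add_norm_sub _ _ _
        _ ≤ T₂ + T₂ := by rw [norm_su2Quat_mul_left_sub, norm_su2Quat_inv_sub_one]; exact add_le_add (hT₂ _) (hT₂ _)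
        _ = 2 * T₂ := by ring
    -- (b) slow factors: `‖q(u'_j) − 1‖ ≤ 3T₁ + 2T₂`, read off a link where `V = 1`
    have hu : ∀ (y : Site 3 L) (j : Fin 3), V (y, j) = 1 → ‖su2Quat (u' (0, j)) - 1‖ ≤ 3 * T₁ + 2 * T₂ := by
      intro y j he
      have h1 : u' (0, j) = (chartSU2 (v' (y, j)))⁻¹ * orthoTube L u' v' (y, j) := by rw [orthoTube_apply]; group
      rw [h1]
      calc ‖su2Quat ((chartSU2 (v' (y, j)))⁻¹ * orthoTube L u' v' (y, j)) - 1‖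
          ≤ ‖su2Quat ((chartSU2 (v' (y, j)))⁻¹ * orthoTube L u' v' (y, j)) - su2Quat (orthoTube L u' v' (y, j))‖ + ‖su2Quat (orthoTube L u' v' (y, j)) - 1‖ :=
            norm_sub_le_norm_sub_add_norm_sub _ _ _
        _ ≤ 3 * T₁ + 2 * T₂ := by
            rw [norm_su2Quat_mul_left_sub, norm_su2Quat_inv_sub_one, FemtoTransferGap.su2Quat_chartSU2 (hv1 (y, j))]
            exact add_le_add (norm_chartQuat_sub_one_le_of_abs_le (hv1 (y, j)) (hT₁ (y, j))) (hU1 (y, j) he)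
    have huk : ‖su2Quat (u' (0, k)) - 1‖ ≤ 3 * T₁ + 2 * T₂ := hu (x₁.shift l) k hk1
    have hul : ‖su2Quat (u' (0, l)) - 1‖ ≤ 3 * T₁ + 2 * T₂ := hu x₁ l hl1
    -- (c) fibre factors: `‖q(chartSU2 v'_e) − 1‖ ≤ (3/2)‖linkEmbed v'‖`
    have hc : ∀ e : Edge 3 L, ‖su2Quat (chartSU2 (v' e)) - 1‖ ≤ 3 / 2 * ‖linkEmbed L v'‖ := by
      intro e
      rw [FemtoTransferGap.su2Quat_chartSU2 (hv1 e)]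
      have h1 := norm_chartQuat_sub_one_sq_le (hv1 e)
      have h2 : ∑ a, v' e a ^ 2 ≤ ‖linkEmbed L v'‖ ^ 2 := by
        rw [norm_linkEmbed_sq]
        exact Finset.single_le_sum (f := fun e' => ∑ a, v' e' a ^ 2) (fun e' _ => Finset.sum_nonneg fun a _ => sq_nonneg _) (Finset.mem_univ e)
      have h3 : ‖chartQuat (v' e) - 1‖ ^ 2 ≤ (3 / 2 * ‖linkEmbed L v'‖) ^ 2 := by nlinarith [norm_nonneg (linkEmbed L v')]
      exact (pow_le_pow_iff_left₀ (norm_nonneg _) (by positivity) two_ne_zero).mp h3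
    -- (d) the plaquette of `U'` at `x₁` in the plane `(k,l)` is within `6R + 2(3T₁+2T₂)²` of `1`
    have hprod : ‖su2Quat (u' (0, k)) - 1‖ * ‖su2Quat (u' (0, l)) - 1‖ ≤ (3 * T₁ + 2 * T₂) ^ 2 := by
      rw [sq]; exact mul_le_mul huk hul (norm_nonneg _) ((norm_nonneg _).trans huk)
    have hsmall : ‖su2Quat (orthoTube L u' v' (x₁, k) * orthoTube L u' v' (x₁.shift k, l) * (orthoTube L u' v' (x₁.shift l, k))⁻¹ *
        (orthoTube L u' v' (x₁, l))⁻¹) - 1‖ ≤ 6 * R + 2 * (3 * T₁ + 2 * T₂) ^ 2 := by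
      simp only [orthoTube_apply]
      refine (norm_su2Quat_plaquette_sub_one_le _ _ _ _ _ _).trans ?_
      linarith [hc (x₁, k), hc (x₁.shift k, l), hc (x₁.shift l, k), hc (x₁, l), hRv, hprod]
    -- (e) the same plaquette from `V`: it is `P(1, b e₀)` conjugated by `g x₁`
    have hVg : V = gaugeTransform g (orthoTube L u' v') := funext hd
    have hhol := hol_gaugeTransform g (orthoTube L u' v') x₁ k l
    rw [← hVg, hVk, hkl1, hk1, hl1, mul_one, inv_one, mul_one, mul_one] at hhol
    have hH : orthoTube L u' v' (x₁, k) * orthoTube L u' v' (x₁.shift k, l) * (orthoTube L u' v' (x₁.shift l, k))⁻¹ * (orthoTube L u' v' (x₁, l))⁻¹ =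
        (g x₁)⁻¹ * gnoPoint (Pi.single (0 : Fin 3) b) * ((g x₁)⁻¹)⁻¹ := by
      rw [hhol]; group
    have hq := norm_su2Quat_conj_sub_one (g x₁)⁻¹ (gnoPoint (Pi.single (0 : Fin 3) b))
    rw [← hH] at hq
    linarith [hsmall, hbig, hq]
  simp_rw [hpt, integral_zero]

end Summit.QuantumFields.YangMills.Theorems.TwistedTraceScaling.Negative.R47

end
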